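import Mathlib
import Literature.Probability.RandomPlanarGeometry.PolygonalDomains

/-!
# A Jordan domain bounded by a lattice polygon is the interior of a union of closed lattice cells

Support file for `PolygonReduction` / `Assembly` (items of routes CardyGluingRDE / CardyPolygonWords
of `CardyFormulaZ2`, stmt-CriticalPhenomena-4784). If the frontier of a Jordan domain `D` lies on
the grid lines `re ∈ dℤ ∪ im ∈ dℤ` of mesh `d > 0`, then `D.carrier` is the interior of the union
of the closed `d`-cells whose centres lie in `D` (`JordanDomain.exists_carrier_eq_interior_cells`).
This is the form of the carrier demanded by the hypothesis of `CardyLatticePolygon`.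

Proof. An open cell misses the grid lines, hence the frontier, so (being convex) it lies inside
`D` or inside the outside component `V` of the Jordan curve theorem
(`JordanDomain.exists_outside`). A point of `D` has a point of `D` in the open cell of its floor
indices nearby, so that cell's centre is in `D`; conversely a point of the interior of the union
off `D` yields a point of `V` in that interior, near which a generic point (off the grid lines)
lies in the open cell of a selected closed cell, which is inside `D` — contradicting `D ∩ V = ∅`.
-/

noncomputable section

namespace Summit.CriticalPhenomena.CardyFormulaZ2.Theorems

namespace LatticePolygonApproximation

open Set Metric Complex
open Literature.Probability.RandomPlanarGeometry

/-- **Off-grid reals nearby**: within any distance of a real number there is a real number that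
is not an integer multiple of `d > 0`. [folklore] -/
theorem exists_near_not_mem_grid {d : ℝ} (hd : 0 < d) (a : ℝ) {r : ℝ} (hr : 0 < r) :
    ∃ a' : ℝ, |a' - a| < r ∧ ∀ k : ℤ, a' ≠ d * k := by
  set m := min (r / 3) (d / 3) with hm
  have hm0 : 0 < m := by rw [hm]; positivity
  have hmr : 2 * m < r := by have := min_le_left (r / 3) (d / 3); rw [hm]; linarith
  have hmd : m < d := by have := min_le_right (r / 3) (d / 3); rw [hm]; linarith
  by_cases h1 : ∀ k : ℤ, a + m ≠ d * k
  · exact ⟨a + m, by rw [add_sub_cancel_left, abs_of_pos hm0]; linarith, h1⟩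
  · push Not at h1
    obtain ⟨k, hk⟩ := h1
    refine ⟨a + 2 * m, by rw [add_sub_cancel_left, abs_of_pos (by positivity)]; exact hmr, ?_⟩
    intro k' hk'
    have hmk : m = d * ((k' : ℝ) - k) := by linear_combination hk' - hk
    have h0 : (0 : ℝ) < (k' : ℝ) - k := by
      by_contra hle
      push Not at hle
      have : d * ((k' : ℝ) - k) ≤ 0 := mul_nonpos_of_nonneg_of_nonpos hd.le hle
      linarith
    have h1' : (k' : ℝ) - k < 1 := by
      by_contra hge
      push Not at hge
      have : d * 1 ≤ d * ((k' : ℝ) - k) := mul_le_mul_of_nonneg_left hge hd.le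
      linarith
    have h0i : (0 : ℤ) < k' - k := by
      have : ((0 : ℤ) : ℝ) < ((k' - k : ℤ) : ℝ) := by push_cast; exact h0
      exact_mod_cast this
    have h1i : k' - k < (1 : ℤ) := by
      have : ((k' - k : ℤ) : ℝ) < ((1 : ℤ) : ℝ) := by push_cast; exact h1'
      exact_mod_cast this
    omega

/-- **Off-grid points nearby**: within any distance of a point of the plane there is a point
neither of whose coordinates is an integer multiple of `d > 0`. [folklore] -/
theorem exists_near_not_mem_gridLines {d : ℝ} (hd : 0 < d) (z : ℂ) {r : ℝ} (hr : 0 < r) :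
    ∃ z' : ℂ, dist z' z < r ∧ (∀ k : ℤ, z'.re ≠ d * k) ∧ ∀ k : ℤ, z'.im ≠ d * k := by
  obtain ⟨x, hx, hxk⟩ := exists_near_not_mem_grid hd z.re (half_pos hr)
  obtain ⟨y, hy, hyk⟩ := exists_near_not_mem_grid hd z.im (half_pos hr)
  refine ⟨⟨x, y⟩, ?_, hxk, hyk⟩
  rw [Complex.dist_eq]
  refine (Complex.norm_le_abs_re_add_abs_im _).trans_lt ?_
  simp only [Complex.sub_re, Complex.sub_im]
  linarith

/-- An open lattice cell of mesh `d` misses the grid lines of mesh `d`. [folklore] -/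
theorem not_mem_gridLines_of_mem_openCell {d : ℝ} (hd : 0 < d) {p : ℤ × ℤ} {z : ℂ}
    (hz : d * (p.1 : ℝ) < z.re ∧ z.re < d * ((p.1 : ℝ) + 1) ∧
      d * (p.2 : ℝ) < z.im ∧ z.im < d * ((p.2 : ℝ) + 1)) :
    ¬ ((∃ k : ℤ, z.re = d * k) ∨ ∃ k : ℤ, z.im = d * k) := by
  rintro (⟨k, hk⟩ | ⟨k, hk⟩)
  · obtain ⟨h1, h2, -, -⟩ := hz
    rw [hk] at h1 h2
    have h1' : (p.1 : ℝ) < k := lt_of_mul_lt_mul_left h1 hd.le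
    have h2' : (k : ℝ) < p.1 + 1 := lt_of_mul_lt_mul_left h2 hd.le
    have h1i : p.1 < k := by exact_mod_cast h1'
    have h2i : k < p.1 + 1 := by exact_mod_cast h2'
    omega
  · obtain ⟨-, -, h1, h2⟩ := hz
    rw [hk] at h1 h2
    have h1' : (p.2 : ℝ) < k := lt_of_mul_lt_mul_left h1 hd.le
    have h2' : (k : ℝ) < p.2 + 1 := lt_of_mul_lt_mul_left h2 hd.le
    have h1i : p.2 < k := by exact_mod_cast h1'
    have h2i : k < p.2 + 1 := by exact_mod_cast h2'
    omega

/-- Open lattice cells are convex. [folklore] -/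
theorem convex_openCell (d : ℝ) (p : ℤ × ℤ) :
    Convex ℝ {z : ℂ | d * (p.1 : ℝ) < z.re ∧ z.re < d * ((p.1 : ℝ) + 1) ∧
      d * (p.2 : ℝ) < z.im ∧ z.im < d * ((p.2 : ℝ) + 1)} := by
  have h : {z : ℂ | d * (p.1 : ℝ) < z.re ∧ z.re < d * ((p.1 : ℝ) + 1) ∧
      d * (p.2 : ℝ) < z.im ∧ z.im < d * ((p.2 : ℝ) + 1)} =
      {z : ℂ | d * (p.1 : ℝ) < z.re} ∩ ({z : ℂ | z.re < d * ((p.1 : ℝ) + 1)} ∩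
        ({z : ℂ | d * (p.2 : ℝ) < z.im} ∩ {z : ℂ | z.im < d * ((p.2 : ℝ) + 1)})) := by
    ext z; simp only [mem_setOf_eq, mem_inter_iff]
  rw [h]
  exact (convex_halfSpace_re_gt _).inter ((convex_halfSpace_re_lt _).inter
    ((convex_halfSpace_im_gt _).inter (convex_halfSpace_im_lt _)))

/-- A point of a closed cell off the grid lines lies in the open cell. [folklore] -/
theorem mem_openCell_of_mem_closedCell {d : ℝ} {p : ℤ × ℤ} {z : ℂ}
    (hz : d * (p.1 : ℝ) ≤ z.re ∧ z.re ≤ d * ((p.1 : ℝ) + 1) ∧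
      d * (p.2 : ℝ) ≤ z.im ∧ z.im ≤ d * ((p.2 : ℝ) + 1))
    (hre : ∀ k : ℤ, z.re ≠ d * k) (him : ∀ k : ℤ, z.im ≠ d * k) :
    d * (p.1 : ℝ) < z.re ∧ z.re < d * ((p.1 : ℝ) + 1) ∧
      d * (p.2 : ℝ) < z.im ∧ z.im < d * ((p.2 : ℝ) + 1) := by
  obtain ⟨h1, h2, h3, h4⟩ := hz
  refine ⟨lt_of_le_of_ne h1 fun h => hre _ h.symm, lt_of_le_of_ne h2 fun h => hre (p.1 + 1) ?_,
    lt_of_le_of_ne h3 fun h => him _ h.symm, lt_of_le_of_ne h4 fun h => him (p.2 + 1) ?_⟩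
  · push_cast; exact h
  · push_cast; exact h

/-- **The carrier of a Jordan domain bounded by a lattice polygon is the interior of a finite
union of closed lattice cells.** If the frontier of the Jordan domain `D` lies on the grid lines
of mesh `d > 0`, then `D.carrier = interior (⋃ p ∈ s, cell p)` for the (finite) set `s` of closed
`d`-cells `[d p₁, d (p₁ + 1)] × [d p₂, d (p₂ + 1)]` whose centres lie in `D`. [folklore] -/
theorem _root_.Literature.Probability.RandomPlanarGeometry.JordanDomain.exists_carrier_eq_interior_cells
    (D : JordanDomain) {d : ℝ} (hd : 0 < d)
    (hgrid : frontier D.carrier ⊆ {z : ℂ | (∃ k : ℤ, z.re = d * k) ∨ ∃ k : ℤ, z.im = d * k}) :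
    ∃ s : Finset (ℤ × ℤ), D.carrier = interior (⋃ p ∈ s,
      {z : ℂ | d * (p.1 : ℝ) ≤ z.re ∧ z.re ≤ d * ((p.1 : ℝ) + 1) ∧
        d * (p.2 : ℝ) ≤ z.im ∧ z.im ≤ d * ((p.2 : ℝ) + 1)}) := by
  classical
  set U := D.carrier with hU
  -- open cells, closed cells, centres
  set cellI : ℤ × ℤ → Set ℂ := fun p => {z : ℂ | d * (p.1 : ℝ) < z.re ∧ z.re < d * ((p.1 : ℝ) + 1) ∧
      d * (p.2 : ℝ) < z.im ∧ z.im < d * ((p.2 : ℝ) + 1)} with hcellI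
  set cellC : ℤ × ℤ → Set ℂ := fun p => {z : ℂ | d * (p.1 : ℝ) ≤ z.re ∧ z.re ≤ d * ((p.1 : ℝ) + 1) ∧
      d * (p.2 : ℝ) ≤ z.im ∧ z.im ≤ d * ((p.2 : ℝ) + 1)} with hcellC
  set ctr : ℤ × ℤ → ℂ := fun p => ⟨d * ((p.1 : ℝ) + 1 / 2), d * ((p.2 : ℝ) + 1 / 2)⟩ with hctr
  have hctr_mem : ∀ p, ctr p ∈ cellI p := by
    intro p
    simp only [hcellI, hctr, mem_setOf_eq]
    refine ⟨?_, ?_, ?_, ?_⟩ <;> nlinarith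
  have hIC : ∀ p, cellI p ⊆ cellC p := fun p z hz => ⟨hz.1.le, hz.2.1.le, hz.2.2.1.le, hz.2.2.2.le⟩
  -- the outside
  obtain ⟨V, hVo, -, hUV, hunion, hfrV, -⟩ :=
    D.exists_outside Literature.Topology.PlaneTopology.JordanCurveTheorem_holds
  -- an open cell lies in `U ∪ V`
  have hcell_sub : ∀ p, cellI p ⊆ U ∪ V := by
    intro p z hz
    rw [hunion]
    intro hzf
    exact not_mem_gridLines_of_mem_openCell hd hz (hgrid hzf)
  have hcell_U : ∀ p, (cellI p ∩ U).Nonempty → cellI p ⊆ U := fun p hne =>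
    (convex_openCell d p).isPreconnected.subset_left_of_subset_union D.isOpen hVo hUV
      (hcell_sub p) hne
  have hcell_V : ∀ p, (cellI p ∩ V).Nonempty → cellI p ⊆ V := fun p hne =>
    (convex_openCell d p).isPreconnected.subset_right_of_subset_union D.isOpen hVo hUV
      (hcell_sub p) hne
  -- the index set is finite
  obtain ⟨ρ, hρ⟩ := (Metric.isBounded_iff_subset_closedBall (0 : ℂ)).1 D.isBounded
  set K : ℤ := ⌈ρ / d⌉ + 1 with hK
  have hfin : {p : ℤ × ℤ | ctr p ∈ U}.Finite := by
    refine ((Set.finite_Icc (-K) K).prod (Set.finite_Icc (-K) K)).subset ?_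
    intro p hp
    have hb := hρ hp
    rw [mem_closedBall, dist_zero_right] at hb
    have hre := (Complex.abs_re_le_norm _).trans hb
    have him := (Complex.abs_im_le_norm _).trans hb
    simp only [hctr] at hre him
    have key : ∀ a : ℤ, |d * ((a : ℝ) + 1 / 2)| ≤ ρ → a ∈ Icc (-K) K := by
      intro a ha
      rw [abs_mul, abs_of_pos hd] at ha
      have ha' : |(a : ℝ) + 1 / 2| ≤ ρ / d := by rwa [le_div_iff₀ hd, mul_comm]
      obtain ⟨h1, h2⟩ := abs_le.1 ha'
      have hc : ρ / d ≤ (⌈ρ / d⌉ : ℝ) := Int.le_ceil _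
      have h3 : (-(K : ℝ)) ≤ a := by rw [hK]; push_cast; linarith
      have h4 : (a : ℝ) ≤ K := by rw [hK]; push_cast; linarith
      exact ⟨by exact_mod_cast h3, by exact_mod_cast h4⟩
    exact ⟨key _ hre, key _ him⟩
  refine ⟨hfin.toFinset, ?_⟩
  have hmem_s : ∀ p, p ∈ hfin.toFinset ↔ ctr p ∈ U := fun p => by
    rw [Set.Finite.mem_toFinset]; rfl
  set Kset := ⋃ p ∈ hfin.toFinset, cellC p with hKset
  -- (1) `U ⊆ Kset`
  have hUK : U ⊆ Kset := by
    intro z hz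
    obtain ⟨r, hr, hball⟩ := Metric.isOpen_iff.1 D.isOpen z hz
    set p : ℤ × ℤ := (⌊z.re / d⌋, ⌊z.im / d⌋) with hp
    have hf1 : d * ((⌊z.re / d⌋ : ℤ) : ℝ) ≤ z.re := by
      have := mul_le_mul_of_nonneg_left (Int.floor_le (z.re / d)) hd.le
      rwa [mul_div_cancel₀ _ hd.ne'] at this
    have hf2 : z.re < d * (((⌊z.re / d⌋ : ℤ) : ℝ) + 1) := by
      have := mul_lt_mul_of_pos_left (Int.lt_floor_add_one (z.re / d)) hd
      rwa [mul_div_cancel₀ _ hd.ne'] at this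
    have hf3 : d * ((⌊z.im / d⌋ : ℤ) : ℝ) ≤ z.im := by
      have := mul_le_mul_of_nonneg_left (Int.floor_le (z.im / d)) hd.le
      rwa [mul_div_cancel₀ _ hd.ne'] at this
    have hf4 : z.im < d * (((⌊z.im / d⌋ : ℤ) : ℝ) + 1) := by
      have := mul_lt_mul_of_pos_left (Int.lt_floor_add_one (z.im / d)) hd
      rwa [mul_div_cancel₀ _ hd.ne'] at this
    -- a point of `U` in the open cell of `p`
    set t : ℝ := min (r / 4) (min ((d * (((⌊z.re / d⌋ : ℤ) : ℝ) + 1) - z.re) / 2)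
      ((d * (((⌊z.im / d⌋ : ℤ) : ℝ) + 1) - z.im) / 2)) with ht
    have ht0 : 0 < t := by
      rw [ht]; exact lt_min (by positivity) (lt_min (by linarith) (by linarith))
    have htr : t ≤ r / 4 := min_le_left _ _
    have ht1 : t ≤ (d * (((⌊z.re / d⌋ : ℤ) : ℝ) + 1) - z.re) / 2 := (min_le_right _ _).trans (min_le_left _ _)
    have ht2 : t ≤ (d * (((⌊z.im / d⌋ : ℤ) : ℝ) + 1) - z.im) / 2 := (min_le_right _ _).trans (min_le_right _ _)
    set z' : ℂ := z + ⟨t, t⟩ with hz'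
    have hz'U : z' ∈ U := by
      refine hball (mem_ball.2 ?_)
      rw [Complex.dist_eq, hz', add_sub_cancel_left]
      refine (Complex.norm_le_abs_re_add_abs_im _).trans_lt ?_
      rw [abs_of_pos ht0]
      linarith
    have hz'I : z' ∈ cellI p := by
      simp only [hcellI, hz', hp, mem_setOf_eq, Complex.add_re, Complex.add_im]
      refine ⟨by linarith, by linarith, by linarith, by linarith⟩
    have hpU : cellI p ⊆ U := hcell_U p ⟨z', hz'I, hz'U⟩
    have hps : p ∈ hfin.toFinset := (hmem_s p).2 (hpU (hctr_mem p))
    rw [hKset]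
    exact mem_biUnion hps ⟨hf1, hf2.le, hf3, hf4.le⟩
  refine Subset.antisymm (interior_maximal hUK D.isOpen) ?_
  -- (2) `interior Kset ⊆ U`
  intro z hz
  by_contra hzU
  -- a point of `V` in `interior Kset`
  obtain ⟨w, hwV, hwK⟩ : ∃ w ∈ V, w ∈ interior Kset := by
    by_cases hzf : z ∈ frontier U
    · rw [← hfrV] at hzf
      have hzc : z ∈ closure V := frontier_subset_closure hzf
      obtain ⟨r, hr, hball⟩ := Metric.isOpen_iff.1 isOpen_interior z hz
      obtain ⟨w, hwV, hwd⟩ := Metric.mem_closure_iff.1 hzc r hr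
      exact ⟨w, hwV, hball (mem_ball'.2 hwd)⟩
    · have : z ∈ U ∪ V := by rw [hunion]; exact hzf
      rcases this with h | h
      · exact absurd h hzU
      · exact ⟨z, h, hz⟩
  obtain ⟨r, hr, hball⟩ := Metric.isOpen_iff.1 (hVo.inter isOpen_interior) w ⟨hwV, hwK⟩
  obtain ⟨z', hz'd, hre, him⟩ := exists_near_not_mem_gridLines hd w hr
  obtain ⟨hz'V, hz'K⟩ := hball (mem_ball.2 hz'd)
  have hz'K' : z' ∈ Kset := interior_subset hz'K
  rw [hKset] at hz'K'
  obtain ⟨p, hps, hz'p⟩ := mem_iUnion₂.1 hz'K'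
  have hz'I : z' ∈ cellI p := mem_openCell_of_mem_closedCell hz'p hre him
  have hpU : cellI p ⊆ U := hcell_U p ⟨ctr p, hctr_mem p, (hmem_s p).1 hps⟩
  exact Set.disjoint_left.1 hUV (hpU hz'I) hz'V

end LatticePolygonApproximation

end Summit.CriticalPhenomena.CardyFormulaZ2.Theorems
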